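import Mathlib.Analysis.InnerProductSpace.Laplacian
import Mathlib.Analysis.Calculus.FDeriv.Equiv
import Literature.Analysis.FluidPDE.ClassicalSolution
import HarnessLib

/-!
# Isometry invariance of the incompressible Navier–Stokes / Euler equations

Trunk: FluidKinetic (topic `Literature/Analysis/FluidPDE`).

Let `E` be a finite-dimensional real inner product space and `R : E ≃ₗᵢ[ℝ] E` a linear isometry
(e.g. a rotation of `ℝ³` about an axis). If `(u, p)` is a classical solution of the forced
incompressible Navier–Stokes system with force `f` on the time set `S`
(`Literature.Analysis.FluidPDE.IsClassicalNSSolutionOn`), then so is the conjugated triple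
`(t, x) ↦ R (u t (R⁻¹ x))`, `(t, x) ↦ p t (R⁻¹ x)`, with force `(t, x) ↦ R (f t (R⁻¹ x))`
(`IsClassicalNSSolutionOn.conj_linearIsometryEquiv`), and uniform rapid decay is preserved
(`HasUniformRapidDecayOn.conj_linearIsometryEquiv`). This is the rotation covariance of the
equations used, together with uniqueness, to propagate axisymmetry
(Koch–Nadirashvili–Seregin–Šverák 2009, §1: "a field `u` is axi-symmetric if `u(Rx) = Ru(x)` for
every rotation `R`"; Majda–Bertozzi, §1.2 (symmetry groups of the Euler and the Navier–Stokes
equations, Prop. 1.1 (iii) rotation symmetry) and §2.3.3).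

## Main statements (all proved)

* pointwise covariance of the operators under `v ↦ R ∘ v ∘ R⁻¹` / `q ↦ q ∘ R⁻¹`:
  `fderiv_conj_linearIsometryEquiv`, `convect_conj_linearIsometryEquiv`,
  `divergence_conj_linearIsometryEquiv`, `gradient_comp_linearIsometryEquiv_symm`,
  `laplacian_comp_linearIsometryEquiv`, `laplacian_conj_linearIsometryEquiv`.
* `IsSmoothSpaceTimeOn.conj_linearIsometryEquiv`, `timeDerivWithin_conj_linearIsometryEquiv`,
  `HasUniformRapidDecayOn.conj_linearIsometryEquiv`.
* `IsClassicalNSSolutionOn.conj_linearIsometryEquiv` (Majda–Bertozzi, Prop. 1.1 (iii), stated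
  there for Euler/Navier–Stokes without forcing; the forced version conjugates `f` as well).
* `IsClassicalNSSolutionOn.congr_force`: the notion only depends on `f t` for `t ∈ S`.

## References

* A. J. Majda, A. L. Bertozzi, *Vorticity and Incompressible Flow* (CUP 2002), §1.2,
  Prop. 1.1 (symmetry groups: (iii) rotation symmetry `v_Q(x,t) = Qᵗ v(Qx, t)`).
* G. Koch, N. Nadirashvili, G. Seregin, V. Šverák, *Liouville theorems for the Navier–Stokes
  equations and applications*, Acta Math. 203 (2009), §1.
-/

noncomputable section

open MeasureTheory Set Function
open scoped ContDiff Laplacian InnerProductSpace RealInnerProductSpace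

namespace Literature.Analysis.FluidPDE

variable {E : Type*} [NormedAddCommGroup E] [InnerProductSpace ℝ E] [FiniteDimensional ℝ E]
variable {F : Type*} [NormedAddCommGroup F] [NormedSpace ℝ F]

/-! ### Pointwise covariance of the differential operators -/

section Pointwise

variable (R : E ≃ₗᵢ[ℝ] E)

omit [FiniteDimensional ℝ E] in
/-- Chain rule for composition on the right with a linear isometry:
`D(g ∘ R⁻¹)(x) = Dg(R⁻¹ x) ∘ R⁻¹` (Majda–Bertozzi, §1.2, proof of Prop. 1.1, chain rule). [folklore] -/
theorem fderiv_comp_linearIsometryEquiv_symm (g : E → F) (x : E) :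
    fderiv ℝ (fun y => g (R.symm y)) x = (fderiv ℝ g (R.symm x)).comp (R.symm : E →L[ℝ] E) :=
  R.symm.toContinuousLinearEquiv.comp_right_fderiv

omit [FiniteDimensional ℝ E] in
/-- Chain rule for the conjugated vector field `x ↦ R (v (R⁻¹ x))`:
`D(R ∘ v ∘ R⁻¹)(x) = R ∘ Dv(R⁻¹ x) ∘ R⁻¹` (Majda–Bertozzi, §1.2, proof of Prop. 1.1). [folklore] -/
theorem fderiv_conj_linearIsometryEquiv (v : E → E) (x : E) :
    fderiv ℝ (fun y => R (v (R.symm y))) x =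
      (R : E →L[ℝ] E).comp ((fderiv ℝ v (R.symm x)).comp (R.symm : E →L[ℝ] E)) := by
  have h1 : (fun y => R (v (R.symm y))) = R ∘ (fun y => v (R.symm y)) := rfl
  rw [h1, R.comp_fderiv, fderiv_comp_linearIsometryEquiv_symm]

omit [FiniteDimensional ℝ E] in
/-- The convective derivative is rotation covariant:
`((Rv R⁻¹·∇)(Rv R⁻¹))(x) = R ((v·∇)v)(R⁻¹ x)` (Majda–Bertozzi, §1.2, Prop. 1.1 (iii)). [folklore] -/
theorem convect_conj_linearIsometryEquiv (v w : E → E) (x : E) :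
    convect (fun y => R (v (R.symm y))) (fun y => R (w (R.symm y))) x =
      R (convect v w (R.symm x)) := by
  simp [convect, fderiv_conj_linearIsometryEquiv]

/-- The divergence is rotation invariant: `div (R v R⁻¹)(x) = div v (R⁻¹ x)` (trace of a
conjugate; Majda–Bertozzi, §1.2, Prop. 1.1 (iii)). [folklore] -/
theorem divergence_conj_linearIsometryEquiv (v : E → E) (x : E) :
    VectorCalculus.divergence (fun y => R (v (R.symm y))) x = VectorCalculus.divergence v (R.symm x) := by
  set b := stdOrthonormalBasis ℝ E
  rw [divergence_eq_sum_inner_fderiv (b.map R), divergence_eq_sum_inner_fderiv b,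
    fderiv_conj_linearIsometryEquiv]
  refine Finset.sum_congr rfl fun i _ => ?_
  simp [LinearIsometryEquiv.inner_map_map]

/-- A conjugated divergence-free field is divergence free. [folklore] -/
theorem VectorCalculus.IsDivFree.conj_linearIsometryEquiv {v : E → E} (hv : VectorCalculus.IsDivFree v) :
    VectorCalculus.IsDivFree (fun y => R (v (R.symm y))) := fun x => by
  rw [divergence_conj_linearIsometryEquiv, hv]

omit [FiniteDimensional ℝ E] in
/-- The gradient is rotation covariant: `∇(q ∘ R⁻¹)(x) = R (∇q (R⁻¹ x))` (Riesz representation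
and `⟪R w, y⟫ = ⟪w, R⁻¹ y⟫`; Majda–Bertozzi, §1.2, Prop. 1.1 (iii)). [folklore] -/
theorem gradient_comp_linearIsometryEquiv_symm [CompleteSpace E] (q : E → ℝ) (x : E) :
    gradient (fun y => q (R.symm y)) x = R (gradient q (R.symm x)) := by
  refine ext_inner_right ℝ fun y => ?_
  rw [gradient, InnerProductSpace.toDual_symm_apply, fderiv_comp_linearIsometryEquiv_symm,
    LinearIsometryEquiv.inner_map_eq_flip, gradient, InnerProductSpace.toDual_symm_apply]
  rfl

/-- The Laplacian is invariant under composition with a linear isometry on the right: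
`Δ(g ∘ R⁻¹)(x) = Δ g (R⁻¹ x)` (sum of second derivatives over the orthonormal basis `R⁻¹ b`;
Majda–Bertozzi, §1.2, Prop. 1.1 (iii)). [folklore] -/
theorem laplacian_comp_linearIsometryEquiv_symm (g : E → F) (x : E) :
    (Δ (fun y => g (R.symm y))) x = (Δ g) (R.symm x) := by
  set b := stdOrthonormalBasis ℝ E
  rw [InnerProductSpace.laplacian_eq_iteratedFDeriv_orthonormalBasis _ b,
    InnerProductSpace.laplacian_eq_iteratedFDeriv_orthonormalBasis _ (b.map R.symm)]
  refine Finset.sum_congr rfl fun i _ => ?_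
  have h1 : (fun y => g (R.symm y)) = g ∘ R.symm.toContinuousLinearEquiv := rfl
  rw [h1, ← iteratedFDerivWithin_univ, ← iteratedFDerivWithin_univ]
  have h2 := R.symm.toContinuousLinearEquiv.iteratedFDerivWithin_comp_right g uniqueDiffOn_univ
    (x := x) (mem_univ _) 2
  rw [preimage_univ] at h2
  rw [h2, ContinuousMultilinearMap.compContinuousLinearMap_apply]
  congr 1
  funext j
  fin_cases j <;> simp

/-- The Laplacian is rotation covariant on vector fields: `Δ(R v R⁻¹)(x) = R (Δ v (R⁻¹ x))`
(Majda–Bertozzi, §1.2, Prop. 1.1 (iii)). [folklore] -/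
theorem laplacian_conj_linearIsometryEquiv (v : E → E) (x : E) :
    (Δ (fun y => R (v (R.symm y)))) x = R ((Δ v) (R.symm x)) := by
  have h1 : (fun y => R (v (R.symm y))) = R.toContinuousLinearEquiv ∘ (fun y => v (R.symm y)) :=
    rfl
  rw [h1, InnerProductSpace.laplacian_CLE_comp_left, Function.comp_apply,
    laplacian_comp_linearIsometryEquiv_symm]
  rfl

end Pointwise

/-! ### Space–time fields: smoothness, time derivative, decay -/

section SpaceTime

variable (R : E ≃ₗᵢ[ℝ] E) {S : Set ℝ}

omit [FiniteDimensional ℝ E] in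
/-- Composition on the right with a linear isometry preserves joint space–time smoothness:
`(t, x) ↦ w t (R⁻¹ x)` is jointly smooth on `S × E` if `w` is. [folklore] -/
theorem IsSmoothSpaceTimeOn.comp_linearIsometryEquiv_symm {w : ℝ → E → F}
    (h : IsSmoothSpaceTimeOn S w) : IsSmoothSpaceTimeOn S (fun t x => w t (R.symm x)) := by
  have h1 : uncurry (fun t x => w t (R.symm x)) =
      uncurry w ∘ (fun z : ℝ × E => (z.1, R.symm z.2)) := by
    funext z; rfl
  rw [IsSmoothSpaceTimeOn, h1]
  refine h.comp ?_ fun z hz => ⟨hz.1, mem_univ _⟩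
  exact (contDiff_fst.prodMk
    (R.symm.toContinuousLinearEquiv.contDiff.comp contDiff_snd)).contDiffOn

omit [FiniteDimensional ℝ E] in
/-- Conjugation by a linear isometry preserves joint space–time smoothness of a vector field:
`(t, x) ↦ R (u t (R⁻¹ x))` is jointly smooth on `S × E` if `u` is. [folklore] -/
theorem IsSmoothSpaceTimeOn.conj_linearIsometryEquiv {u : ℝ → E → E}
    (h : IsSmoothSpaceTimeOn S u) : IsSmoothSpaceTimeOn S (fun t x => R (u t (R.symm x))) := by
  have h1 : uncurry (fun t x => R (u t (R.symm x))) =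
      R.toContinuousLinearEquiv ∘ uncurry (fun t x => u t (R.symm x)) := by
    funext z; rfl
  rw [IsSmoothSpaceTimeOn, h1]
  exact R.toContinuousLinearEquiv.contDiff.comp_contDiffOn (h.comp_linearIsometryEquiv_symm R)

omit [FiniteDimensional ℝ E] in
/-- The one-sided time derivative commutes with composition on the right in space
(definitional). [folklore] -/
theorem timeDerivWithin_comp_linearIsometryEquiv_symm (w : ℝ → E → F) (t : ℝ) (x : E) :
    timeDerivWithin S (fun s y => w s (R.symm y)) t x = timeDerivWithin S w t (R.symm x) :=
  rfl

omit [FiniteDimensional ℝ E] in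
/-- The one-sided time derivative of the conjugated field: `∂ₜ(R u R⁻¹)(t, x) = R (∂ₜu (t, R⁻¹ x))`
for a jointly smooth `u` on a time set of unique differentiability. [folklore] -/
theorem timeDerivWithin_conj_linearIsometryEquiv {u : ℝ → E → E} (h : IsSmoothSpaceTimeOn S u)
    (hS : UniqueDiffOn ℝ S) {t : ℝ} (ht : t ∈ S) (x : E) :
    timeDerivWithin S (fun s y => R (u s (R.symm y))) t x =
      R (timeDerivWithin S u t (R.symm x)) := by
  simp only [timeDerivWithin_apply]
  have hd : HasDerivWithinAt (fun s => u s (R.symm x))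
      (derivWithin (fun s => u s (R.symm x)) S t) S t :=
    (h.differentiableWithinAt_time ht (R.symm x)).hasDerivWithinAt
  exact ((R : E →L[ℝ] E).hasFDerivAt.comp_hasDerivWithinAt t hd).derivWithin (hS t ht)

omit [FiniteDimensional ℝ E] in
/-- Conjugation by a linear isometry preserves uniform rapid decay: the space–time derivatives
of `(t, x) ↦ R (u t (R⁻¹ x))` have the same norms as those of `u` at `(t, R⁻¹ x)`, and
`‖R⁻¹ x‖ = ‖x‖`. [folklore] -/
theorem HasUniformRapidDecayOn.conj_linearIsometryEquiv {u : ℝ → E → E}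
    (hd : HasUniformRapidDecayOn S u) (hS : UniqueDiffOn ℝ S) :
    HasUniformRapidDecayOn S (fun t x => R (u t (R.symm x))) := by
  intro n K
  obtain ⟨C, hC⟩ := hd n K
  refine ⟨C, fun t ht x => ?_⟩
  let Φ : (ℝ × E) ≃ₗᵢ[ℝ] (ℝ × E) :=
    ⟨(LinearEquiv.refl ℝ ℝ).prodCongr R.symm.toLinearEquiv, fun z => by simp [Prod.norm_def]⟩
  have hΦ : ∀ z, Φ z = (z.1, R.symm z.2) := fun z => rfl
  have h1 : uncurry (fun t x => R (u t (R.symm x))) = R ∘ (uncurry u ∘ Φ) := by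
    funext z; rfl
  have hpre : Φ ⁻¹' (S ×ˢ (univ : Set E)) = S ×ˢ univ := by
    ext z; simp [hΦ]
  have hU : UniqueDiffOn ℝ (S ×ˢ (univ : Set E)) := hS.prod uniqueDiffOn_univ
  have hmem : (t, x) ∈ S ×ˢ (univ : Set E) := ⟨ht, mem_univ _⟩
  rw [h1, LinearIsometryEquiv.norm_iteratedFDerivWithin_comp_left _ _ hU hmem]
  have h2 := LinearIsometryEquiv.norm_iteratedFDerivWithin_comp_right Φ (uncurry u) hU
    (x := (t, x)) (by rw [hΦ]; exact ⟨ht, mem_univ _⟩) n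
  rw [hpre] at h2
  rw [h2, hΦ]
  simpa using hC t ht (R.symm x)

end SpaceTime

/-! ### Covariance of classical solutions -/

section Solutions

variable (R : E ≃ₗᵢ[ℝ] E) {S : Set ℝ} {ν : ℝ} {f u : ℝ → E → E} {p : ℝ → E → ℝ}

/-- **Rotation (isometry) covariance of the Navier–Stokes / Euler equations.** If `(u, p)` is a
classical solution with force `f` on a time set `S` of unique differentiability, then
`(t, x) ↦ R (u t (R⁻¹ x))`, `(t, x) ↦ p t (R⁻¹ x)` is a classical solution with force
`(t, x) ↦ R (f t (R⁻¹ x))` and the same viscosity (Majda–Bertozzi, §1.2, Prop. 1.1 (iii):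
rotation symmetry `v_Q (x, t) = Qᵗ v (Q x, t)`, here `Q = R⁻¹`, extended to forced equations;
KNSS 2009, §1). Each operator is covariant pointwise (`timeDerivWithin_conj_linearIsometryEquiv`,
`convect_conj_linearIsometryEquiv`, `laplacian_conj_linearIsometryEquiv`,
`gradient_comp_linearIsometryEquiv_symm`, `divergence_conj_linearIsometryEquiv`). [cite: MajdaBertozziCUP2002, §1.2 Prop. 1.1 (iii)] -/
theorem IsClassicalNSSolutionOn.conj_linearIsometryEquiv (h : IsClassicalNSSolutionOn S ν f u p)
    (hS : UniqueDiffOn ℝ S) :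
    IsClassicalNSSolutionOn S ν (fun t x => R (f t (R.symm x))) (fun t x => R (u t (R.symm x)))
      (fun t x => p t (R.symm x)) where
  smooth_velocity := h.smooth_velocity.conj_linearIsometryEquiv R
  smooth_pressure := h.smooth_pressure.comp_linearIsometryEquiv_symm R
  momentum t ht x := by
    have hm := congrArg R (h.momentum t ht (R.symm x))
    rw [timeDerivWithin_conj_linearIsometryEquiv R h.smooth_velocity hS ht,
      convect_conj_linearIsometryEquiv, laplacian_conj_linearIsometryEquiv,
      gradient_comp_linearIsometryEquiv_symm, ← map_add, hm, map_add, map_sub,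
      LinearIsometryEquiv.map_smul]
  divFree t ht := (h.divFree t ht).conj_linearIsometryEquiv R

omit [FiniteDimensional ℝ E] in
/-- The notion of classical solution only involves the force at times `t ∈ S`. [folklore] -/
theorem IsClassicalNSSolutionOn.congr_force [FiniteDimensional ℝ E] {g : ℝ → E → E}
    (h : IsClassicalNSSolutionOn S ν f u p) (hfg : ∀ t ∈ S, ∀ x, f t x = g t x) :
    IsClassicalNSSolutionOn S ν g u p where
  smooth_velocity := h.smooth_velocity
  smooth_pressure := h.smooth_pressure
  momentum t ht x := by
    rw [← hfg t ht x]
    exact h.momentum t ht x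
  divFree := h.divFree

end Solutions

end Literature.Analysis.FluidPDE
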